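import Literature.AnabelianGeometry.EtaleTheta.KummerContainerValuationTransport
import HarnessLib

/-!
# Twisted Kummer classes of FIXED elements and `ℤ`-valued characters: the NORM over a finite-index normal
# level, at an ABSTRACT pair `G ↷ A` (proof-only)

Sources.  LANA Project interim report [LANA2026Report], §6.1 pp. 31–32 (the Kummer map
`κ : M → lim_{→ H} H¹(H, Λ(M))`); S. Mochizuki, *Inter-universal Teichmüller theory I*, Example 5.1 (v) p. 127
l. 76 – p. 128 l. 2 ("by considering divisors of zeroes and poles … associated to Kummer classes of rational
functions as in [AbsTopIII], Proposition 1.6, (iii), from the elementary observation `ℚ_{>0} ∩ Ẑ^× = {1}`")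
[Mochizuki2012]; *Topics in Absolute Anabelian Geometry III*, Prop. 1.6 (iii) p. 36 [MochizukiAbsTopIII2015].
Classical: the norm `N_{L/k}(z) = ∏_{σ ∈ Gal(L/k)} σ z` of a finite Galois level [NeukirchSchmidtWingberg2008, I §5].

**What was in the tree.**  abc-iut-w4-d057's `KummerContainerValuationTransport.lean` (p433474):
`exists_level_forall_pow_eq_of_H1ColimTwist_kummerMap_eq` (generic: `u · κ(x) = κ(y)` in the container ⇒ at ONE
level `S j`, for every `n`, `x^{χₙ(u)} · y⁻¹` is an `n`-th power IN `A^{S j}`), `ZHatLevel.apply_eta_eq_eta_of_forall_dvd`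
(`(∀ n, n ∣ d·(χₙ(u)·a − b)) ⇒ u(η a) = η b`), and the NORM STEP at the ARITHMETIC instance `Γ_k ↷ k̄^×` (Galois
correspondence + `Algebra.norm`).  abc-iut-w4-d056's `KummerTwistInertia.lean` (p432953): the same conclusion from
INERTIA data.

**What this file proves** (PROOF-ONLY; classical): the norm step at an ABSTRACT pair `G ↷ A` — no field, no Galois
correspondence, no inertia:
* `exists_fixed_pow_eq_pow_index` — **the coset-product norm**: for `H ⊴ G` of finite index, `w ∈ A^H` with
  `wⁿ = c`, `c` fixed by `G`: `v := ∏_{q ∈ G/H} q̃ · w` (any representatives `q̃`) is FIXED BY `G` and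
  `vⁿ = c^{[G:H]}`;
* **`apply_eta_eq_eta_of_H1ColimTwist_kummerMap_eq_of_fixed`** — for a directed exhaustive system `S` of NORMAL
  FINITE-INDEX subgroups [the open normal subgroups of a profinite group], `x, y ∈ A` FIXED BY `G`, and
  `u · κ(x) = κ(y)` in `lim_{→ i} H¹(S i, Λ A)`: **`u(η(φ x)) = η(φ y)` for EVERY `φ : A → ℤ` additive on products of
  `G`-fixed elements** (a "`ℤ`-valued character of `(A^G)`": a valuation / order function at a point).  Proof:
  w4-d057's level step, the coset-product norm (`n ∣ [G : S j]·(χₙ(u)·φ x − φ y)` for all `n`), `Ẑ` by levels.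

Consumer: [IUTchI] Ex. 5.1 (v) law (b′) at the interface `N : NFBridgeRecon` (GAP-LEDGER G-w4d056-2) with NO
inertia data — `Literature/IUT/HodgeTheaters/GlobalFrobenioidsCoricRigidityOfOrdHom.lean`.  HONEST FRAMING: OUR kernel
check of classical statements; nothing here bears on [IUTchIII] Cor. 3.12; no statement of the disputed series is
asserted.  Groups and modules live in `Type`.
-/

namespace Literature.AnabelianGeometry.EtaleTheta

open ProfiniteGrp ProfiniteGrp.ProfiniteCompletion

/-! ## The coset-product norm over a finite-index normal subgroup -/

section Norm

variable {G : Type*} [Group G] {A : Type*} [CommGroup A] [MulDistribMulAction G A]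

/-- Representatives of the same left coset act alike on an `H`-fixed element. [cite: NeukirchSchmidtWingberg2008, I §5] -/
theorem smul_eq_smul_of_mk_eq (H : Subgroup G) {w : A} (hw : w ∈ MulAction.fixedPoints H A) {a b : G}
    (hab : (a : G ⧸ H) = b) : a • w = b • w := by
  have hmem : a⁻¹ * b ∈ H := QuotientGroup.eq.mp hab
  have h1 : (a⁻¹ * b) • w = w := hw ⟨a⁻¹ * b, hmem⟩
  calc a • w = a • ((a⁻¹ * b) • w) := by rw [h1]
    _ = b • w := by rw [smul_smul, mul_inv_cancel_left]

/-- **The coset-product norm.**  Let `H ⊴ G` have finite index, `w ∈ A^H`, and `c ∈ A` be fixed by `G` with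
`wⁿ = c`.  Then some `G`-FIXED `v` satisfies `vⁿ = c^{[G:H]}` — namely `v := ∏_{q ∈ G/H} q̃ · w` for representatives
`q̃` (independent of the choice since `w` is `H`-fixed; `G` permutes the cosets; each factor has `n`-th power `c`).
[cite: NeukirchSchmidtWingberg2008, I §5] -/
theorem exists_fixed_pow_eq_pow_index (H : Subgroup G) [H.Normal] [H.FiniteIndex] {w c : A}
    (hw : w ∈ MulAction.fixedPoints H A) (hc : ∀ g : G, g • c = c) {n : ℕ} (hwn : w ^ n = c) :
    ∃ v : A, (∀ g : G, g • v = v) ∧ v ^ n = c ^ H.index := by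
  classical
  haveI : Fintype (G ⧸ H) := H.fintypeQuotientOfFiniteIndex
  refine ⟨∏ q : G ⧸ H, q.out • w, fun g => ?_, ?_⟩
  · -- `G` permutes the cosets; representatives of a coset act alike on `w`
    rw [Finset.smul_prod']
    simp_rw [smul_smul]
    have hrep : ∀ q : G ⧸ H, (g * q.out) • w = (g • q).out • w := fun q =>
      smul_eq_smul_of_mk_eq H hw (by
        rw [QuotientGroup.out_eq', ← MulAction.Quotient.coe_smul_out, smul_eq_mul])
    simp_rw [hrep]
    exact Fintype.prod_bijective (g • ·) (MulAction.bijective g) _ _ fun _ => rfl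
  · rw [← Finset.prod_pow]
    simp_rw [← smul_pow', hwn, hc]
    rw [Finset.prod_const, Finset.card_univ, Subgroup.index_eq_card, Nat.card_eq_fintype_card]

end Norm

/-! ## Twisted Kummer classes of `G`-fixed elements and `ℤ`-valued characters -/

section Character

variable {G : Type} [Group G] {A : Type} [CommGroup A] [MulDistribMulAction G A]
  {ι : Type} [Preorder ι] [DecidableEq ι] [IsDirectedOrder ι] (S : ι → Subgroup G)
  (hS : ∀ ⦃i j : ι⦄, i ≤ j → S j ≤ S i) [RootableBy A ℕ]

/-- **`u(η(φ x)) = η(φ y)` for fixed `x, y` with `u · κ(x) = κ(y)` and every `ℤ`-valued character `φ` of the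
fixed elements** ([IUTchI] Ex. 5.1 (v) law (b′) / [AbsTopIII] Prop. 1.6 (iii) "divisors of Kummer classes",
ABSTRACT form).  Let `S` be a directed exhaustive system of NORMAL FINITE-INDEX subgroups of `G` [the open normal
subgroups of a profinite group], `x, y ∈ A` fixed by `G`, `u ∈ Ẑ^× = Aut(Ẑ)` with `u · κ(x) = κ(y)` in
`lim_{→ i} H¹(S i, Λ A)`, and `φ : A → ℤ` additive on products of `G`-fixed elements.  THEN `u(η(φ x)) = η(φ y)`:
at one level `S j`, `x^{χₙ(u)} y⁻¹ = wₙⁿ` with `wₙ ∈ A^{S j}` (w4-d057), the coset-product norm gives a `G`-fixed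
`vₙ` with `vₙⁿ = (x^{χₙ(u)} y⁻¹)^{[G:S j]}`, so `n ∣ [G:S j]·(χₙ(u)·φ x − φ y)` for all `n`.  PROVED.
[cite: MochizukiAbsTopIII2015, Proposition 1.6 (iii) p.36] -/
theorem apply_eta_eq_eta_of_H1ColimTwist_kummerMap_eq_of_fixed (hc : IsExhausted A S)
    [hN : ∀ i, (S i).Normal] (hfi : ∀ i, (S i).FiniteIndex) {x y : A} (hx : ∀ g : G, g • x = x)
    (hy : ∀ g : G, g • y = y) (u : MulAut (completion (GrpCat.of (Multiplicative ℤ))))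
    (h : H1ColimTwist S hS u (kummerMap hS hc x) = kummerMap hS hc y) (φ : A → ℤ)
    (hφ : ∀ a b : A, (∀ g : G, g • a = a) → (∀ g : G, g • b = b) → φ (a * b) = φ a + φ b) :
    u (ZHatLevel.eta (φ x)) = ZHatLevel.eta (φ y) := by
  obtain ⟨j, -, -, hroots⟩ := exists_level_forall_pow_eq_of_H1ColimTwist_kummerMap_eq S hS hc x y u h
  haveI := hfi j
  -- bookkeeping for the character `φ` on the subgroup of `G`-fixed elements
  have hφ1 : φ 1 = 0 := by
    have h11 := hφ 1 1 (fun g => smul_one g) (fun g => smul_one g)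
    rw [mul_one] at h11
    omega
  have hfixinv : ∀ {a : A}, (∀ g : G, g • a = a) → ∀ g : G, g • a⁻¹ = a⁻¹ := fun ha g => by
    rw [smul_inv', ha g]
  have hfixpow : ∀ {a : A}, (∀ g : G, g • a = a) → ∀ (k : ℕ) (g : G), g • a ^ k = a ^ k := fun ha k g => by
    rw [smul_pow', ha g]
  have hφinv : ∀ {a : A}, (∀ g : G, g • a = a) → φ a⁻¹ = -φ a := fun {a} ha => by
    have h0 := hφ a a⁻¹ ha (hfixinv ha)
    rw [mul_inv_cancel, hφ1] at h0
    omega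
  have hφpow : ∀ {a : A}, (∀ g : G, g • a = a) → ∀ k : ℕ, φ (a ^ k) = k * φ a := by
    intro a ha k
    induction k with
    | zero => rw [pow_zero, hφ1, Nat.cast_zero, zero_mul]
    | succ k ih => rw [pow_succ, hφ (a ^ k) a (hfixpow ha k) ha, ih]; push_cast; ring
  refine ZHatLevel.apply_eta_eq_eta_of_forall_dvd u (d := ⟨(S j).index, Nat.pos_of_ne_zero Subgroup.FiniteIndex.index_ne_zero⟩) fun n => ?_
  obtain ⟨w, hw, hwn⟩ := hroots n
  -- `c := x^{χₙ(u)} y⁻¹` is `G`-fixed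
  have hcfix : ∀ g : G, g • (x ^ (ZHatLevel.levelChar n u).val * y⁻¹) = x ^ (ZHatLevel.levelChar n u).val * y⁻¹ :=
    fun g => by rw [smul_mul', hfixpow hx, hfixinv hy]
  obtain ⟨v, hv, hvn⟩ := exists_fixed_pow_eq_pow_index (S j) hw hcfix hwn
  -- read `φ` on `vⁿ = c^{[G : S j]}`
  have hread := congrArg φ hvn
  rw [hφpow hv, hφpow hcfix, hφ _ _ (hfixpow hx _) (hfixinv hy), hφpow hx, hφinv hy] at hread
  refine ⟨φ v, ?_⟩
  rw [PNat.mk_coe]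
  linarith [hread]

/-- The same with the twist on the other side: `κ(y) = u · κ(x)` (the shape of hypothesis `hord` of
`CoricPair.kummerRigid_of_divisors`). [cite: MochizukiAbsTopIII2015, Proposition 1.6 (iii) p.36] -/
theorem apply_eta_eq_eta_of_kummerMap_eq_H1ColimTwist_of_fixed (hc : IsExhausted A S)
    [hN : ∀ i, (S i).Normal] (hfi : ∀ i, (S i).FiniteIndex) {x y : A} (hx : ∀ g : G, g • x = x)
    (hy : ∀ g : G, g • y = y) (u : MulAut (completion (GrpCat.of (Multiplicative ℤ))))
    (h : kummerMap hS hc y = H1ColimTwist S hS u (kummerMap hS hc x)) (φ : A → ℤ)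
    (hφ : ∀ a b : A, (∀ g : G, g • a = a) → (∀ g : G, g • b = b) → φ (a * b) = φ a + φ b) :
    u (ZHatLevel.eta (φ x)) = ZHatLevel.eta (φ y) :=
  apply_eta_eq_eta_of_H1ColimTwist_kummerMap_eq_of_fixed S hS hc hfi hx hy u h.symm φ hφ

end Character

end Literature.AnabelianGeometry.EtaleTheta
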